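import Summits.ValiantsHypothesis.ValiantsHypothesis.Theses.LacunarySymmetroid
import Summits.ValiantsHypothesis.ValiantsHypothesis.Theorems.LacunarySymmetroidPencilTransfer

/-!
# `MatrixDescartes` — negative lemma modulo `RVPMonster` (the image of the pencil transfer)

Crux `stmt-ValiantsHypothesis-18050` (`Theses.LacunarySymmetroid.MatrixDescartes`, MDR).  Transfer audit of
route `route-ValiantsHypothesis-LacunarySymmetroid`: the kernel-proved transfer
`Theorems.LacunarySymmetroid.pencilTransfer_proof` (`PencilTransfer`: every real family with VP
complexification, restricted to a monomial curve `yᵢ = X^{dᵢ}`, is the zero set of the determinant of a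
real SYMMETRIC lacunary pencil of quasi-polynomial size) feeds MDR only with pencils in its IMAGE.  On that
image MDR says exactly: no real VP family has `≥ 2^{n⌊log₂ n⌋} − 1` distinct real zeros on a monomial curve
eventually — i.e. `¬ RVPMonster` below (`RVPMonster` = the route's proved `ThetaWitness` with `IsVNPFamily`
replaced by `IsVPFamily`).  This file makes that door a kernel theorem:

  `MatrixDescartes_false_of_RVPMonster : RVPMonster → ¬ MatrixDescartes`,

and records the parametric surplus of the crux: the door already closes on the single exponent `q = 4`
(`matrixDescartes_qFour_false_of_RVPMonster`: the `q = 4` slices of MDR, all `c`), the only value of `q`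
the assembly `closes` ever uses.

Status of `H = RVPMonster` (why it is not constructible here): a real VP monster is an OPEN construction —
under `VP = VNP` it exists (the tree's `thetaWitness_proof` family becomes VP), so `¬ RVPMonster` implies
Valiant's hypothesis and cannot be cheaper than the summit; conversely no real VP family with
`2^{Ω(n log n)}` real zeros on a monomial curve is in print (nearest: Koiran's real τ-conjecture for
ΣΠΣ-of-sparse, Koiran 2011; the τ-conjecture for Newton polygons, Koiran–Portier–Tavenas–Thomassé 2015;
Hrubeš–Yehudayoff 2021, Open Problem 1 on Birkhoff shadows for the tropical shadow of the same question).
`RVPMonster ∧ (VP ≠ VNP)` is consistent with everything known, so a construction of `H` would sink the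
route while leaving the summit open: MDR is a DISTINCT conjecture, strictly above `¬ RVPMonster ⇒ VH`.

[topic AlgebraicComplexity/RealTauConjecture] [folklore] contraposition of the route's own assembly.
-/

-- `Summit.ValiantsHypothesis.ValiantsHypothesis.…` repeats a component by the D-0017 layout
-- (single-conjunct summit), which the `dupNamespace` linter flags; the name is mandated.
set_option linter.dupNamespace false

namespace Summit.ValiantsHypothesis.ValiantsHypothesis.Theorems.MatrixDescartes.Negative

open Summit.ValiantsHypothesis.ValiantsHypothesis.Theses.LacunarySymmetroid
open scoped BigOperators

/-- **H (construction target, open):** a *real VP monster* — a real polynomial family `Θₙ` in `n`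
variables whose complexification is a VP family, and exponent vectors `dₙ`, such that eventually the
lacunary restriction `Θₙ(X^{dₙ})` has at least `2^{n⌊log₂ n⌋} − 1` distinct real zeros.  Literally the
route's `ThetaWitness` with `IsVNPFamily` replaced by `IsVPFamily`; under `VP = VNP` the proved
`ThetaWitness` family is one.  [topic AlgebraicComplexity/RealTauConjecture] -/
def RVPMonster : Prop :=
  ∃ (Θ : ∀ n : ℕ, MvPolynomial (Fin n) ℝ) (d : ∀ n : ℕ, Fin n → ℕ),
    Literature.Computability.AlgebraicComplexity.IsVPFamily
        (fun n => MvPolynomial.map (algebraMap ℝ ℂ) (Θ n)) ∧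
      ∃ n₀ : ℕ, ∀ n : ℕ, n₀ ≤ n →
        2 ^ (n * Nat.log 2 n) ≤
          (MvPolynomial.aeval (fun i => (Polynomial.X : Polynomial ℝ) ^ d n i) (Θ n)).roots.toFinset.card
            + 1

/-- The door closes on the `q = 4` slices alone (the only exponent the assembly `closes` uses):
a real VP monster, pushed through the kernel-proved `pencilTransfer_proof`, is a family of symmetric
lacunary pencils of quasi-polynomial size violating `Z⁴ ≤ 2^{K⌊log₂K⌋}` for all large `K = n + 1`. -/
theorem matrixDescartes_qFour_false_of_RVPMonster (hM : RVPMonster) :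
    ¬ ∀ c : ℕ, ∃ K₀ : ℕ, ∀ K m : ℕ, K₀ ≤ K → m ≤ 2 ^ ((Nat.log 2 K + c) ^ c) →
      ∀ (d : Fin K → ℕ) (S : Fin K → Matrix (Fin m) (Fin m) ℝ), (∀ l, (S l).IsSymm) →
        (Matrix.det (∑ l, ((Polynomial.X : Polynomial ℝ) ^ d l) • (S l).map Polynomial.C)).roots.toFinset.card
          ^ 4 ≤ 2 ^ (K * Nat.log 2 K) := by
  intro hMDR
  obtain ⟨Θ, d, hVP, n₀, hroots⟩ := hM
  obtain ⟨c, hc⟩ := Theorems.LacunarySymmetroid.pencilTransfer_proof (fun n => n) Θ hVP d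
  obtain ⟨K₀, hK⟩ := hMDR c
  obtain ⟨n, hn₀, hnK, hn4⟩ : ∃ n, n₀ ≤ n ∧ K₀ ≤ n ∧ 4 ≤ n := ⟨n₀ + K₀ + 4, by omega, by omega, by omega⟩
  obtain ⟨m, hm, S, hS, hroot⟩ := hc n
  set Z := (MvPolynomial.aeval (fun i => (Polynomial.X : Polynomial ℝ) ^ d n i) (Θ n)).roots.toFinset.card
    with hZ
  have hm' : m ≤ 2 ^ ((Nat.log 2 (n + 1) + c) ^ c) :=
    hm.trans (Nat.pow_le_pow_right (by norm_num)
      (Nat.pow_le_pow_left (Nat.add_le_add_right (Nat.log_mono_right (Nat.le_succ n)) c) c))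
  have h1 := hK (n + 1) m (by omega) hm' (Fin.cons (α := fun _ => ℕ) (0 : ℕ) (d n)) S hS
  rw [hroot] at h1
  have h2 : 2 ^ (n * Nat.log 2 n) ≤ Z + 1 := hroots n hn₀
  set L := Nat.log 2 n with hL
  have hL2 : 2 ≤ L := by
    rw [hL]
    calc 2 = Nat.log 2 4 := by decide
      _ ≤ Nat.log 2 n := Nat.log_mono_right hn4
  have hLn : L ≤ n := by rw [hL]; exact Nat.log_le_self 2 n
  have hL' : Nat.log 2 (n + 1) ≤ L + 1 := by
    rw [hL]
    calc Nat.log 2 (n + 1) ≤ Nat.log 2 (n * 2) := Nat.log_mono_right (by omega)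
      _ = Nat.log 2 n + 1 := Nat.log_mul_base (by norm_num) (by omega)
  have h3 : Z ^ 4 ≤ 2 ^ ((n + 1) * (L + 1)) :=
    h1.trans (Nat.pow_le_pow_right (by norm_num) (Nat.mul_le_mul_left _ hL'))
  have hnL : 1 ≤ n * L := by nlinarith
  have h4 : 2 ^ (n * L - 1) ≤ Z := by
    have e : 2 ^ (n * L) = 2 * 2 ^ (n * L - 1) := by
      rw [← Nat.pow_succ']
      congr 1
      omega
    have h2' := h2
    rw [e] at h2'
    have : 1 ≤ 2 ^ (n * L - 1) := Nat.one_le_two_pow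
    omega
  have h5 : 2 ^ (4 * (n * L - 1)) ≤ Z ^ 4 := by
    rw [pow_mul']
    exact Nat.pow_le_pow_left h4 4
  have h6 : 4 * (n * L - 1) ≤ (n + 1) * (L + 1) :=
    (Nat.pow_le_pow_iff_right (by norm_num)).1 (h5.trans h3)
  have h7 : 6 * n ≤ 3 * (n * L) := by nlinarith
  have h6' : 4 * (n * L - 1) ≤ n * L + n + L + 1 := by
    have e : (n + 1) * (L + 1) = n * L + n + L + 1 := by ring
    rw [e] at h6
    exact h6
  generalize hP : n * L = P at h6' h7 hnL
  omega

/-- **Negative lemma modulo `RVPMonster`.**  `¬ MatrixDescartes` modulo the open construction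
`RVPMonster` (a real VP family with `2^{n⌊log₂n⌋} − 1` real zeros on a monomial curve, eventually):
the image of the route's own transfer is a separating family for the crux — a monster refutes MDR
through `pencilTransfer_proof` while leaving `VP ≠ VNP` untouched. -/
theorem MatrixDescartes_false_of_RVPMonster (hM : RVPMonster) : ¬ MatrixDescartes :=
  fun h => matrixDescartes_qFour_false_of_RVPMonster hM (fun c => h c 4 (by norm_num))

end Summit.ValiantsHypothesis.ValiantsHypothesis.Theorems.MatrixDescartes.Negative
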